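import Mathlib.Analysis.Fourier.Convolution
import Mathlib.Analysis.Fourier.Inversion
import Mathlib.Analysis.Calculus.BumpFunction.Normed
import Mathlib.Analysis.SpecialFunctions.Trigonometric.Bounds
import Mathlib.Geometry.Manifold.PartitionOfUnity
import Literature.Analysis.Fourier.TitchmarshPaleyWienerProofs
import HarnessLib

/-!
# The spectrum of a product of bounded band-limited functions (Titchmarsh–Lions on the
# Fourier side) — proofs
(topic `Analysis/Fourier`; sibling of `TitchmarshPaleyWiener.lean` and
`TitchmarshPaleyWienerProofs.lean`)

This file DISCHARGES the named fact
`Literature.Analysis.Fourier.Titchmarsh_fourierSpectrum_mul` ("exact spectral radii add under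
multiplication": for non-zero bounded continuous `f, g : ℝ → ℂ` with bounded spectra,
`sup spec (fg) = sup spec f + sup spec g` and likewise for `inf`):

* `Titchmarsh_fourierSpectrum_mul_of_convolution_support :
    Titchmarsh1926_convolution_support → Titchmarsh_fourierSpectrum_mul` — the reduction of the
  distributional statement to the theorem of supports for FUNCTIONS (Titchmarsh 1926, Thm. VII;
  Hörmander Thm. 4.3.3 for `n = 1`), proved in this file;
* `Titchmarsh_fourierSpectrum_mul_holds : Titchmarsh_fourierSpectrum_mul` — the discharge, by
  the reduction and `Titchmarsh1926_convolution_support_holds`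
  (`TitchmarshPaleyWienerProofs.lean`).

## The printed proof and how it is formalised

In print (Hörmander, *ALPDO I*): `f̂, ĝ ∈ ℰ'(ℝ)`, `(fg)^ = f̂ ∗ ĝ` (Thm. 7.1.15) and
`ch supp (f̂ ∗ ĝ) = ch supp f̂ + ch supp ĝ` (Thm. 4.3.3, the theorem of supports). Mathlib has no
convolution of distributions, so the distributional identities are replaced by their standard
REGULARISED versions, which are identities between functions:

1. **Pairing and gluing.** `Λ_h(θ) = ∫ h · 𝓕θ` is the tempered distribution `ĥ` for bounded `h`;
   `fourierSpectrum h` (defined in the sibling file by local non-vanishing) is its support, and a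
   distribution vanishes off its support: `∫ h · 𝓕θ = 0` for every compactly supported Schwartz `θ`
   with `tsupport θ ∩ fourierSpectrum h = ∅` (`integral_mul_fourier_eq_zero_of_disjoint_fourierSpectrum`,
   by a smooth partition of unity, `linearMap_apply_eq_zero_of_locally_zero`; Hörmander Thm. 2.2.1).
2. **Regularisation.** `ρ_n` = normalised bump supported in `[-1/(n+1), 1/(n+1)]`, `ψ_n = 𝓕ρ_n`
   (`|ψ_n| ≤ 1`, `ψ_n → 1` pointwise: `norm_fourier_sub_one_le`, `tendsto_fourier_bump`), and
   `F_n = 𝓕(f ψ_n)`. The modulation identity `F_n(ξ) = Λ_f(ρ_n(· − ξ))`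
   (`fourier_mul_fourier_apply`) shows that `F_n` is a continuous function supported in the
   `1/(n+1)`-neighbourhood of `spec f` (`support_fourier_mul_fourier_bump_subset`), so compactly
   supported; Fourier inversion and Fubini give `𝓕(fψ_n · gψ_n) = F_n ⋆ G_n`
   (`fourier_fourierInv_mul_eq_convolution`, `fourier_mul_bump_mul_eq_convolution` — the
   function form of Thm. 7.1.15), and the multiplication formula gives `Λ_{fψ_n}(φ) = ∫ F_n φ`.
   Dominated convergence: `Λ_{fψ_n}(φ) → Λ_f(φ)` (`tendsto_integral_mul_mul_fourier`).
3. **Spectra.** A non-zero bounded continuous `f` has non-empty spectrum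
   (`fourierSpectrum_nonempty`: otherwise `F_n ≡ 0`, so `fψ_n ≡ 0`, so `f = 0`; Thm. 7.1.10);
   `spec (fg) ⊆ (-∞, sup spec f + sup spec g]` (`integral_mul_mul_fourier_eq_zero_of_subset_Ioi`,
   from `supp (F_n ⋆ G_n) ⊆ supp F_n + supp G_n`); and the Titchmarsh step
   `sup spec f + sup spec g ∈ spec (fg)` (`sSup_add_sSup_mem_fourierSpectrum_mul`): if `(fg)^`
   vanished near `c = sup spec f + sup spec g`, then for `n` large `F_n ⋆ G_n` would vanish on
   `(c − 3δ, ∞)`, so by the theorem of supports for the FUNCTIONS `F_n, G_n` one of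
   `sup supp F_n < sup spec f − δ`, `sup supp G_n < sup spec g − δ` holds for infinitely many `n`,
   contradicting `∫ F_n φ_f → Λ_f(φ_f) ≠ 0` for a test function `φ_f` supported in
   `(sup spec f − δ, ∞)` (which exists because `sup spec f ∈ spec f`, the spectrum being closed).
4. The `inf` statement is the `sup` statement for `f(-·)`, `g(-·)`
   (`fourierSpectrum_comp_neg`, `Real.sInf_def`).

What is NOT here: the theorem of supports for functions itself
(`Titchmarsh1926_convolution_support_holds`, Hörmander's real-variable proof, in
`TitchmarshPaleyWienerProofs.lean`), and the Paley–Wiener fact `PaleyWienerSchwartz_bounded_iff`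
of the sibling file, which is not needed on this road.

## References

* L. Hörmander, *The Analysis of Linear Partial Differential Operators I*, 2nd ed., Springer 1990:
  Thm. 2.2.1 (gluing / vanishing off the support), Def. 2.2.2, Thm. 4.3.3 (theorem of supports),
  Thm. 7.1.10 (Fourier inversion in `𝒮'`), Thm. 7.1.15 (`(u₁ ∗ u₂)^ = û₁ û₂`). [HormanderALPDO1]
* E. C. Titchmarsh, *The zeros of certain integral functions*, Proc. London Math. Soc. (2) 25
  (1926) 283–302, Thm. VII. [Titchmarsh1926]

## Mathlib

Used: `SchwartzMap.fourierTransformCLM`, `SchwartzMap.compSubConstCLM`,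
`SchwartzMap.compCLMOfContinuousLinearEquiv`, `SchwartzMap.convolution` / `fourier_convolution`,
`HasCompactSupport.toSchwartzMap`, `SmoothPartitionOfUnity.exists_isSubordinate`,
`ContDiffBump.normed`, `VectorFourier.integral_bilin_fourierIntegral_eq_flip`,
`Continuous.fourierInv_fourier_eq`, `support_convolution_subset`,
`tendsto_integral_of_dominated_convergence`, `Real.norm_exp_I_mul_ofReal_sub_one_le`.
-/

noncomputable section

open MeasureTheory FourierTransform Filter Set Real
open scoped SchwartzMap Topology Real Convolution ContDiff Manifold

namespace Literature.Analysis.Fourier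

/-! ### The pairing `θ ↦ ∫ h · 𝓕θ` for a bounded function `h` -/

section Pairing

variable {h : ℝ → ℂ} {C : ℝ}

/-- The function-level Fourier transform of a Schwartz function is the Schwartz Fourier transform
(definitional). [folklore] -/
theorem fourier_coe_eq_fourierTransformCLM (θ : 𝓢(ℝ, ℂ)) :
    𝓕 (θ : ℝ → ℂ) = ⇑(SchwartzMap.fourierTransformCLM ℂ θ) := rfl

/-- `h · 𝓕θ` is integrable for `h` bounded measurable and `θ` Schwartz. [folklore] -/
theorem integrable_mul_fourier_schwartz (hh : AEStronglyMeasurable h) (hC : ∀ x, ‖h x‖ ≤ C)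
    (θ : 𝓢(ℝ, ℂ)) : Integrable fun x => h x * 𝓕 (θ : ℝ → ℂ) x := by
  have hi : Integrable (𝓕 θ : 𝓢(ℝ, ℂ)) := (𝓕 θ).integrable
  exact hi.bdd_mul hh (ae_of_all _ hC)

/-- Additivity of `θ ↦ ∫ h · 𝓕θ`. [folklore] -/
theorem integral_mul_fourier_add (hh : AEStronglyMeasurable h) (hC : ∀ x, ‖h x‖ ≤ C)
    (θ₁ θ₂ : 𝓢(ℝ, ℂ)) :
    ∫ x, h x * 𝓕 ((θ₁ + θ₂ : 𝓢(ℝ, ℂ)) : ℝ → ℂ) x =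
      (∫ x, h x * 𝓕 (θ₁ : ℝ → ℂ) x) + ∫ x, h x * 𝓕 (θ₂ : ℝ → ℂ) x := by
  rw [← integral_add (integrable_mul_fourier_schwartz hh hC θ₁)
    (integrable_mul_fourier_schwartz hh hC θ₂)]
  refine integral_congr_ae (ae_of_all _ fun x => ?_)
  simp only [fourier_coe_eq_fourierTransformCLM, map_add, add_apply, mul_add]

/-- Homogeneity of `θ ↦ ∫ h · 𝓕θ`. [folklore] -/
theorem integral_mul_fourier_smul (h : ℝ → ℂ) (c : ℂ) (θ : 𝓢(ℝ, ℂ)) :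
    ∫ x, h x * 𝓕 ((c • θ : 𝓢(ℝ, ℂ)) : ℝ → ℂ) x = c * ∫ x, h x * 𝓕 (θ : ℝ → ℂ) x := by
  rw [← integral_const_mul]
  refine integral_congr_ae (ae_of_all _ fun x => ?_)
  simp only [fourier_coe_eq_fourierTransformCLM, map_smul, smul_apply, smul_eq_mul]
  ring

end Pairing

/-! ### Gluing local vanishing (smooth partitions of unity) -/

/-- **Gluing.** A linear functional on `𝓢(ℝ, ℂ)` that vanishes on compactly supported test
functions near every point of the (compact) support of `φ` vanishes on `φ` (smooth partition of
unity). [folklore] -/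
theorem linearMap_apply_eq_zero_of_locally_zero (Λ : 𝓢(ℝ, ℂ) →ₗ[ℂ] ℂ) (φ : 𝓢(ℝ, ℂ))
    (hφ : HasCompactSupport (φ : ℝ → ℂ))
    (hloc : ∀ x ∈ tsupport (φ : ℝ → ℂ), ∃ V ∈ 𝓝 x, ∀ θ : 𝓢(ℝ, ℂ),
      HasCompactSupport (θ : ℝ → ℂ) → tsupport (θ : ℝ → ℂ) ⊆ V → Λ θ = 0) :
    Λ φ = 0 := by
  classical
  choose! V hV hVΛ using hloc
  set K := tsupport (φ : ℝ → ℂ) with hK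
  -- a finite subcover of `K` by the open sets `interior (V x)`, `x ∈ K`
  obtain ⟨t, ht⟩ := hφ.elim_finite_subcover (fun x : K => interior (V x))
    (fun _ => isOpen_interior)
    (fun x hx => mem_iUnion.2 ⟨⟨x, hx⟩, mem_interior_iff_mem_nhds.2 (hV x hx)⟩)
  -- a smooth partition of unity on `K` subordinate to it
  obtain ⟨ρ, hρ⟩ := SmoothPartitionOfUnity.exists_isSubordinate 𝓘(ℝ, ℝ) (isClosed_tsupport _)
    (fun i : t => interior (V ((i : K) : ℝ))) (fun _ => isOpen_interior)
    (fun x hx => by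
      obtain ⟨i, hi, hx'⟩ := mem_iUnion₂.1 (ht hx)
      exact mem_iUnion.2 ⟨⟨i, hi⟩, hx'⟩)
  -- the pieces `ρ_i φ`
  have hsm : ∀ i : t, ContDiff ℝ ∞ fun x => (ρ i x) • φ x := fun i =>
    (contMDiff_iff_contDiff.1 (ρ i).contMDiff).smul (φ.smooth ⊤)
  have hcs : ∀ i : t, HasCompactSupport fun x => (ρ i x) • φ x := fun i =>
    hφ.mono (Function.support_smul_subset_right (⇑(ρ i) : ℝ → ℝ) (φ : ℝ → ℂ))
  set ψ : t → 𝓢(ℝ, ℂ) := fun i => (hcs i).toSchwartzMap (hsm i) with hψ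
  have hsum : φ = ∑ i, ψ i := by
    ext x
    rw [sum_apply]
    simp only [hψ, HasCompactSupport.toSchwartzMap_toFun]
    rw [← Finset.sum_smul]
    by_cases hx : x ∈ K
    · rw [← finsum_eq_sum_of_fintype, ρ.sum_eq_one hx, one_smul]
    · rw [image_eq_zero_of_notMem_tsupport hx, smul_zero]
  rw [hsum, map_sum]
  refine Finset.sum_eq_zero fun i _ => hVΛ _ (i : K).2 _ (hcs i) ?_
  calc tsupport (ψ i : ℝ → ℂ) ⊆ tsupport (ρ i) := tsupport_smul_subset_left _ _
    _ ⊆ interior (V ((i : K) : ℝ)) := hρ i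
    _ ⊆ V _ := interior_subset


/-- **A distribution vanishes off its support**, for `Λ_h(θ) = ∫ h · 𝓕θ` with `h` bounded:
if `θ` has compact support disjoint from `fourierSpectrum h`, then `∫ h · 𝓕θ = 0`.
[cite: HormanderALPDO1, Def. 2.2.2 (and Thm. 2.2.1)] -/
theorem integral_mul_fourier_eq_zero_of_disjoint_fourierSpectrum {h : ℝ → ℂ} {C : ℝ}
    (hh : AEStronglyMeasurable h) (hC : ∀ x, ‖h x‖ ≤ C) (θ : 𝓢(ℝ, ℂ))
    (hθ : HasCompactSupport (θ : ℝ → ℂ))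
    (hdisj : Disjoint (tsupport (θ : ℝ → ℂ)) (fourierSpectrum h)) :
    ∫ x, h x * 𝓕 (θ : ℝ → ℂ) x = 0 := by
  let Λ : 𝓢(ℝ, ℂ) →ₗ[ℂ] ℂ :=
    { toFun := fun θ => ∫ x, h x * 𝓕 (θ : ℝ → ℂ) x
      map_add' := fun θ₁ θ₂ => integral_mul_fourier_add hh hC θ₁ θ₂
      map_smul' := fun c θ => integral_mul_fourier_smul h c θ }
  change Λ θ = 0
  refine linearMap_apply_eq_zero_of_locally_zero Λ θ hθ fun x hx => ?_
  have hxs : x ∉ fourierSpectrum h := Set.disjoint_left.1 hdisj hx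
  simp only [mem_fourierSpectrum_iff, not_forall, not_exists, not_and, not_not] at hxs
  obtain ⟨U, hU, hUΛ⟩ := hxs
  exact ⟨U, hU, fun θ' _ hθ'U => hUΛ θ' hθ'U⟩

/-! ### Fourier-analytic identities on `ℝ` -/

/-- The multiplication formula `∫ 𝓕h · φ = ∫ h · 𝓕φ` for integrable functions on `ℝ`.
[folklore] -/
theorem integral_fourier_mul_eq_flip {h φ : ℝ → ℂ} (hh : Integrable h)
    (hφ : Integrable φ) : ∫ ξ, 𝓕 h ξ * φ ξ = ∫ x, h x * 𝓕 φ x := by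
  simpa using! VectorFourier.integral_bilin_fourierIntegral_eq_flip (ContinuousLinearMap.mul ℂ ℂ)
    (L := innerₗ ℝ) continuous_fourierChar continuous_inner hh hφ

/-- Products of values of the Fourier character. [folklore] -/
theorem fourierChar_coe_mul (a b : ℝ) : ((𝐞 a : ℂ)) * 𝐞 b = 𝐞 (a + b) := by
  rw [← Circle.coe_mul, ← AddChar.map_add_eq_mul]

/-- The Fourier transform of a translate: `𝓕(θ(· − ξ))(x) = 𝐞(−ξx) 𝓕θ(x)`. [folklore] -/
theorem fourier_comp_sub_const (θ : ℝ → ℂ) (ξ x : ℝ) :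
    𝓕 (fun u => θ (u - ξ)) x = 𝐞 (-(ξ * x)) * 𝓕 θ x := by
  simp only [Real.fourier_real_eq, Circle.smul_def, smul_eq_mul]
  rw [← integral_sub_right_eq_self (μ := volume) (fun v => (𝐞 (-(v * x)) : ℂ) * θ (v - ξ)) (-ξ)]
  simp only [sub_neg_eq_add, add_sub_cancel_right, ← integral_const_mul]
  congr 1 with v
  rw [← mul_assoc, fourierChar_coe_mul]
  congr 2
  ring

/-- The inverse Fourier transform on `ℝ` as an integral against the character. [folklore] -/
theorem fourierInv_real_eq_char_mul (F : ℝ → ℂ) (x : ℝ) : 𝓕⁻ F x = ∫ v, (𝐞 (v * x) : ℂ) * F v := by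
  rw [Real.fourierInv_eq]
  simp only [Circle.smul_def, smul_eq_mul]
  congr 1 with v
  simp [mul_comm]

/-- **Modulation.** For `h` bounded and `θ` Schwartz,
`𝓕(h · 𝓕θ)(ξ) = ∫ h · 𝓕(θ(· − ξ))`: the value at `ξ` of the Fourier transform of the regularised
function is the pairing of `ĥ` with the translate of `θ` to `ξ`. [folklore] -/
theorem fourier_mul_fourier_apply (h : ℝ → ℂ) (θ : 𝓢(ℝ, ℂ)) (ξ : ℝ) :
    𝓕 (fun x => h x * 𝓕 (θ : ℝ → ℂ) x) ξ =
      ∫ x, h x * 𝓕 ((SchwartzMap.compSubConstCLM ℂ ξ θ : 𝓢(ℝ, ℂ)) : ℝ → ℂ) x := by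
  rw [Real.fourier_real_eq]
  refine integral_congr_ae (ae_of_all _ fun x => ?_)
  have hcoe : ((SchwartzMap.compSubConstCLM ℂ ξ θ : 𝓢(ℝ, ℂ)) : ℝ → ℂ) = fun u => θ (u - ξ) := by
    funext u
    simp
  dsimp only
  rw [hcoe, fourier_comp_sub_const, Circle.smul_def, smul_eq_mul, mul_comm x ξ]
  ring

/-- Support of a translate. [folklore] -/
theorem tsupport_compSubConst_subset (θ : 𝓢(ℝ, ℂ)) {ε : ℝ} (ξ : ℝ)
    (hθ : tsupport (θ : ℝ → ℂ) ⊆ Metric.closedBall 0 ε) :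
    tsupport ((SchwartzMap.compSubConstCLM ℂ ξ θ : 𝓢(ℝ, ℂ)) : ℝ → ℂ) ⊆ Metric.closedBall ξ ε := by
  refine closure_minimal (fun u hu => ?_) Metric.isClosed_closedBall
  have hu' : θ (u - ξ) ≠ 0 := by simpa using hu
  have hmem : u - ξ ∈ Metric.closedBall (0 : ℝ) ε := hθ (subset_tsupport _ hu')
  simpa [Metric.mem_closedBall, dist_eq_norm] using hmem

/-- A translate of a compactly supported Schwartz function has compact support. [folklore] -/
theorem hasCompactSupport_compSubConst (θ : 𝓢(ℝ, ℂ)) (ξ : ℝ)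
    (hθ : HasCompactSupport (θ : ℝ → ℂ)) :
    HasCompactSupport ((SchwartzMap.compSubConstCLM ℂ ξ θ : 𝓢(ℝ, ℂ)) : ℝ → ℂ) := by
  have : ((SchwartzMap.compSubConstCLM ℂ ξ θ : 𝓢(ℝ, ℂ)) : ℝ → ℂ) = (θ : ℝ → ℂ) ∘ (Homeomorph.subRight ξ) := by
    funext u
    simp
  rw [this]
  exact hθ.comp_homeomorph _

/-! ### `𝓕(𝓕⁻F · h) = F ⋆ 𝓕h` -/

/-- **Fourier transform of a product as a convolution**: if `F` and `h` are integrable on `ℝ`,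
then `𝓕(𝓕⁻F · h) = F ⋆ 𝓕h` (Fubini). [folklore] -/
theorem fourier_fourierInv_mul_eq_convolution {F h : ℝ → ℂ} (hF : Integrable F)
    (hh : Integrable h) :
    𝓕 (fun x => 𝓕⁻ F x * h x) = F ⋆[ContinuousLinearMap.mul ℂ ℂ] 𝓕 h := by
  funext ξ
  rw [Real.fourier_real_eq, convolution_def]
  simp only [ContinuousLinearMap.mul_apply', Circle.smul_def, smul_eq_mul, fourierInv_real_eq_char_mul]
  -- the double integrand
  set G : ℝ → ℝ → ℂ := fun x v => (𝐞 (-(x * ξ)) : ℂ) * ((𝐞 (v * x) : ℂ) * F v) * h x with hG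
  have hG_int : Integrable (Function.uncurry G) (volume.prod volume) := by
    have hprod : Integrable (fun p : ℝ × ℝ => ‖h p.1‖ * ‖F p.2‖) (volume.prod volume) :=
      hh.norm.mul_prod hF.norm
    refine hprod.mono' ?_ (ae_of_all _ fun p => ?_)
    · have h1 : AEStronglyMeasurable
          (fun p : ℝ × ℝ => (𝐞 (-(p.1 * ξ)) : ℂ) * (𝐞 (p.2 * p.1) : ℂ)) (volume.prod volume) := by
        fun_prop
      have h2 : AEStronglyMeasurable (fun p : ℝ × ℝ => F p.2) (volume.prod volume) :=
        hF.aestronglyMeasurable.comp_snd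
      have h3 : AEStronglyMeasurable (fun p : ℝ × ℝ => h p.1) (volume.prod volume) :=
        hh.aestronglyMeasurable.comp_fst
      refine ((h1.mul h2).mul h3).congr (ae_of_all _ fun p => ?_)
      rcases p with ⟨x, v⟩
      change (𝐞 (-(x * ξ)) : ℂ) * (𝐞 (v * x) : ℂ) * F v * h x = G x v
      simp only [hG]
      ring
    · rcases p with ⟨x, v⟩
      change ‖G x v‖ ≤ ‖h x‖ * ‖F v‖
      simp only [hG, norm_mul, Circle.norm_coe, one_mul]
      rw [mul_comm]
  calc ∫ x, (𝐞 (-(x * ξ)) : ℂ) * ((∫ v, (𝐞 (v * x) : ℂ) * F v) * h x)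
      = ∫ x, ∫ v, G x v := by
        refine integral_congr_ae (ae_of_all _ fun x => ?_)
        dsimp only
        rw [← integral_mul_const, ← integral_const_mul]
        exact integral_congr_ae (ae_of_all _ fun v => by simp only [hG]; ring)
    _ = ∫ v, ∫ x, G x v := integral_integral_swap hG_int
    _ = ∫ v, F v * 𝓕 h (ξ - v) := by
        refine integral_congr_ae (ae_of_all _ fun v => ?_)
        dsimp only
        rw [Real.fourier_real_eq, ← integral_const_mul]
        refine integral_congr_ae (ae_of_all _ fun x => ?_)
        simp only [hG, Circle.smul_def, smul_eq_mul]
        calc (𝐞 (-(x * ξ)) : ℂ) * ((𝐞 (v * x) : ℂ) * F v) * h x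
            = ((𝐞 (-(x * ξ)) : ℂ) * 𝐞 (v * x)) * (F v * h x) := by ring
          _ = (𝐞 (-(x * (ξ - v))) : ℂ) * (F v * h x) := by
              rw [fourierChar_coe_mul]; congr 2; ring
          _ = F v * ((𝐞 (-(x * (ξ - v))) : ℂ) * h x) := by ring

/-! ### Regularising kernels: normalised bumps on the Fourier side -/

/-- **Normalised bump.** For `ε > 0` there is a Schwartz `ρ` supported in `[-ε, ε]` with
`∫ ρ = 1` and `∫ |ρ| = 1` (a `ContDiffBump.normed`). [folklore] -/
theorem exists_normed_bump {ε : ℝ} (hε : 0 < ε) :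
    ∃ ρ : 𝓢(ℝ, ℂ), tsupport (ρ : ℝ → ℂ) ⊆ Metric.closedBall 0 ε ∧
      HasCompactSupport (ρ : ℝ → ℂ) ∧ (∫ x, ρ x = 1) ∧ (∫ x, ‖ρ x‖ = 1) := by
  let b : ContDiffBump (0 : ℝ) := ⟨ε / 2, ε, half_pos hε, half_lt_self hε⟩
  set r : ℝ → ℝ := b.normed volume with hr
  have hr_smooth : ContDiff ℝ ∞ (fun x => (r x : ℂ)) :=
    Complex.ofRealCLM.contDiff.comp b.contDiff_normed
  have hr_supp : HasCompactSupport (fun x => (r x : ℂ)) :=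
    b.hasCompactSupport_normed.comp_left Complex.ofReal_zero
  refine ⟨hr_supp.toSchwartzMap hr_smooth, ?_, hr_supp, ?_, ?_⟩
  · change tsupport (Complex.ofReal ∘ r) ⊆ _
    refine (tsupport_comp_subset Complex.ofReal_zero r).trans ?_
    rw [hr, b.tsupport_normed_eq]
  · change ∫ x, (r x : ℂ) = 1
    rw [integral_complex_ofReal, hr, b.integral_normed, Complex.ofReal_one]
  · change ∫ x, ‖(r x : ℂ)‖ = 1
    have : ∀ x, ‖(r x : ℂ)‖ = r x := fun x => by
      rw [Complex.norm_real, Real.norm_of_nonneg (b.nonneg_normed x)]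
    simp_rw [this]
    rw [hr, b.integral_normed]

/-- `|𝓕ρ| ≤ 1` when `∫ |ρ| = 1`. [folklore] -/
theorem norm_fourier_le_one_of_integral_norm (ρ : 𝓢(ℝ, ℂ)) (h1 : ∫ x, ‖ρ x‖ = 1) (x : ℝ) :
    ‖𝓕 (ρ : ℝ → ℂ) x‖ ≤ 1 := by
  rw [← h1]
  exact VectorFourier.norm_fourierIntegral_le_integral_norm 𝐞 volume (innerₗ ℝ) ρ x

/-- `|𝐞(t) − 1| ≤ 2π|t|`. [folklore] -/
theorem norm_fourierChar_sub_one_le (t : ℝ) : ‖(𝐞 t : ℂ) - 1‖ ≤ 2 * π * |t| := by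
  rw [Real.fourierChar_apply, mul_comm _ Complex.I]
  refine (Real.norm_exp_I_mul_ofReal_sub_one_le).trans (le_of_eq ?_)
  rw [Real.norm_eq_abs, abs_mul, abs_of_pos Real.two_pi_pos]

/-- **The regularised windows tend to `1`**: if `ρ` is supported in `[-ε, ε]` with `∫ ρ = 1` and
`∫ |ρ| = 1`, then `|𝓕ρ(x) − 1| ≤ 2π ε |x|`. [folklore] -/
theorem norm_fourier_sub_one_le (ρ : 𝓢(ℝ, ℂ)) {ε : ℝ}
    (hsupp : tsupport (ρ : ℝ → ℂ) ⊆ Metric.closedBall 0 ε) (h1 : ∫ x, ρ x = 1)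
    (h1' : ∫ x, ‖ρ x‖ = 1) (x : ℝ) :
    ‖𝓕 (ρ : ℝ → ℂ) x - 1‖ ≤ 2 * π * ε * |x| := by
  have hint : Integrable fun v : ℝ => (𝐞 (-(v * x)) : ℂ) * ρ v := by
    simpa [Circle.smul_def, mul_comm x] using
      (Real.fourierIntegral_convergent_iff x).2 (ρ.integrable (μ := volume))
  have hsub : 𝓕 (ρ : ℝ → ℂ) x - 1 = ∫ v, ((𝐞 (-(v * x)) : ℂ) - 1) * ρ v := by
    rw [Real.fourier_real_eq]
    simp only [Circle.smul_def, smul_eq_mul, sub_mul, one_mul]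
    rw [integral_sub hint (ρ.integrable (μ := volume)), h1]
  rw [hsub]
  have hpt : ∀ v, ‖((𝐞 (-(v * x)) : ℂ) - 1) * ρ v‖ ≤ 2 * π * ε * |x| * ‖ρ v‖ := by
    intro v
    rw [norm_mul]
    by_cases hv : ρ v = 0
    · simp [hv]
    · have hvε : |v| ≤ ε := by
        have := hsupp (subset_tsupport _ hv)
        simpa [Metric.mem_closedBall] using this
      gcongr
      calc ‖(𝐞 (-(v * x)) : ℂ) - 1‖ ≤ 2 * π * |-(v * x)| := norm_fourierChar_sub_one_le _
        _ = 2 * π * (|v| * |x|) := by rw [abs_neg, abs_mul]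
        _ ≤ 2 * π * (ε * |x|) := by gcongr
        _ = 2 * π * ε * |x| := by ring
  calc ‖∫ v, ((𝐞 (-(v * x)) : ℂ) - 1) * ρ v‖ ≤ ∫ v, ‖((𝐞 (-(v * x)) : ℂ) - 1) * ρ v‖ :=
        norm_integral_le_integral_norm _
    _ ≤ ∫ v, 2 * π * ε * |x| * ‖ρ v‖ :=
        integral_mono_of_nonneg (ae_of_all _ fun _ => norm_nonneg _)
          ((ρ.integrable (μ := volume)).norm.const_mul _) (ae_of_all _ hpt)
    _ = 2 * π * ε * |x| := by rw [integral_const_mul, h1', mul_one]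

/-- **The regularised windows tend to `1`** along `ε_n = 1/(n+1)`. [folklore] -/
theorem tendsto_fourier_bump (ρ : ℕ → 𝓢(ℝ, ℂ))
    (hsupp : ∀ n, tsupport (ρ n : ℝ → ℂ) ⊆ Metric.closedBall 0 (((n : ℝ) + 1)⁻¹))
    (h1 : ∀ n, ∫ x, ρ n x = 1) (h1' : ∀ n, ∫ x, ‖ρ n x‖ = 1) (x : ℝ) :
    Tendsto (fun n => 𝓕 (ρ n : ℝ → ℂ) x) atTop (𝓝 1) := by
  rw [tendsto_iff_norm_sub_tendsto_zero]
  have hb : ∀ n, ‖𝓕 (ρ n : ℝ → ℂ) x - 1‖ ≤ 2 * π * ((n : ℝ) + 1)⁻¹ * |x| := fun n =>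
    norm_fourier_sub_one_le (ρ n) (hsupp n) (h1 n) (h1' n) x
  have hlim : Tendsto (fun n : ℕ => 2 * π * ((n : ℝ) + 1)⁻¹ * |x|) atTop (𝓝 0) := by
    have h0 : Tendsto (fun n : ℕ => ((n : ℝ) + 1)⁻¹) atTop (𝓝 0) := by
      simpa only [one_div] using tendsto_one_div_add_atTop_nhds_zero_nat (𝕜 := ℝ)
    simpa using (h0.const_mul (2 * π)).mul_const |x|
  exact squeeze_zero (fun n => norm_nonneg _) hb hlim

/-- **Self-convolution of the bump**: `σ = ρ ⋆ ρ` is Schwartz, `𝓕σ = (𝓕ρ)²`, and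
`supp σ ⊆ [-2ε, 2ε]`. [folklore] -/
theorem exists_self_convolution (ρ : 𝓢(ℝ, ℂ)) {ε : ℝ}
    (hsupp : tsupport (ρ : ℝ → ℂ) ⊆ Metric.closedBall 0 ε) :
    ∃ σ : 𝓢(ℝ, ℂ), (∀ x, 𝓕 (σ : ℝ → ℂ) x = 𝓕 (ρ : ℝ → ℂ) x * 𝓕 (ρ : ℝ → ℂ) x) ∧
      tsupport (σ : ℝ → ℂ) ⊆ Metric.closedBall 0 (2 * ε) ∧ HasCompactSupport (σ : ℝ → ℂ) := by
  set σ := SchwartzMap.convolution (ContinuousLinearMap.mul ℂ ℂ) ρ ρ with hσ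
  have hF : ∀ x, 𝓕 (σ : ℝ → ℂ) x = 𝓕 (ρ : ℝ → ℂ) x * 𝓕 (ρ : ℝ → ℂ) x := by
    intro x
    have h := congrArg (fun φ : 𝓢(ℝ, ℂ) => φ x)
      (SchwartzMap.fourier_convolution (ContinuousLinearMap.mul ℂ ℂ) ρ ρ)
    simpa [SchwartzMap.pairing_apply_apply, SchwartzMap.fourier_coe] using h
  have hcoe : (σ : ℝ → ℂ) = (ρ : ℝ → ℂ) ⋆[ContinuousLinearMap.mul ℂ ℂ] (ρ : ℝ → ℂ) := by
    funext x
    exact SchwartzMap.convolution_apply _ ρ ρ x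
  have hts : tsupport (σ : ℝ → ℂ) ⊆ Metric.closedBall 0 (2 * ε) := by
    refine closure_minimal ?_ Metric.isClosed_closedBall
    rw [hcoe]
    refine (support_convolution_subset _).trans ?_
    rintro _ ⟨a, ha, b, hb, rfl⟩
    have ha' := hsupp (subset_tsupport _ ha)
    have hb' := hsupp (subset_tsupport _ hb)
    rw [Metric.mem_closedBall, dist_zero_right] at ha' hb' ⊢
    calc ‖a + b‖ ≤ ‖a‖ + ‖b‖ := norm_add_le _ _
      _ ≤ ε + ε := add_le_add ha' hb'
      _ = 2 * ε := by ring
  exact ⟨σ, hF, hts, HasCompactSupport.of_support_subset_isCompact (isCompact_closedBall 0 (2 * ε))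
    (subset_tsupport _ |>.trans hts)⟩

/-! ### The regularised Fourier transforms `𝓕(f · 𝓕ρ)` of a bounded continuous `f` -/

section Regularised

variable {f g : ℝ → ℂ} {C C' : ℝ}

/-- `f · 𝓕ρ` is integrable. [folklore] -/
theorem integrable_mul_fourier_bump (hf : Continuous f) (hC : ∀ x, ‖f x‖ ≤ C) (ρ : 𝓢(ℝ, ℂ)) :
    Integrable fun x => f x * 𝓕 (ρ : ℝ → ℂ) x :=
  integrable_mul_fourier_schwartz hf.aestronglyMeasurable hC ρ

/-- `f · 𝓕ρ` is continuous. [folklore] -/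
theorem continuous_mul_fourier_bump (hf : Continuous f) (ρ : 𝓢(ℝ, ℂ)) :
    Continuous fun x => f x * 𝓕 (ρ : ℝ → ℂ) x :=
  hf.mul (𝓕 ρ).continuous

/-- `𝓕(f · 𝓕ρ)` is continuous. [folklore] -/
theorem continuous_fourier_mul_fourier_bump (hf : Continuous f) (hC : ∀ x, ‖f x‖ ≤ C)
    (ρ : 𝓢(ℝ, ℂ)) : Continuous (𝓕 (fun x => f x * 𝓕 (ρ : ℝ → ℂ) x)) :=
  VectorFourier.fourierIntegral_continuous continuous_fourierChar continuous_inner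
    (integrable_mul_fourier_bump hf hC ρ)

/-- **`𝓕(f · 𝓕ρ)` vanishes at distance `> ε` from the spectrum of `f`** (`ρ` supported in
`[-ε, ε]`): the Fourier side of `supp (f̂ ∗ ρ̌) ⊆ supp f̂ + supp ρ̌`. [folklore] -/
theorem fourier_mul_fourier_bump_eq_zero (hf : Continuous f) (hC : ∀ x, ‖f x‖ ≤ C)
    (ρ : 𝓢(ℝ, ℂ)) {ε : ℝ} (hρ : tsupport (ρ : ℝ → ℂ) ⊆ Metric.closedBall 0 ε)
    (hρc : HasCompactSupport (ρ : ℝ → ℂ)) {ξ : ℝ}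
    (hξ : Disjoint (Metric.closedBall ξ ε) (fourierSpectrum f)) :
    𝓕 (fun x => f x * 𝓕 (ρ : ℝ → ℂ) x) ξ = 0 := by
  rw [fourier_mul_fourier_apply]
  exact integral_mul_fourier_eq_zero_of_disjoint_fourierSpectrum hf.aestronglyMeasurable hC _
    (hasCompactSupport_compSubConst ρ ξ hρc) (hξ.mono_left (tsupport_compSubConst_subset ρ ξ hρ))

/-- **`𝓕(f · 𝓕ρ)` is supported in the `ε`-neighbourhood of a ball containing the spectrum.**
[folklore] -/
theorem support_fourier_mul_fourier_bump_subset (hf : Continuous f) (hC : ∀ x, ‖f x‖ ≤ C)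
    (ρ : 𝓢(ℝ, ℂ)) {ε : ℝ} (hρ : tsupport (ρ : ℝ → ℂ) ⊆ Metric.closedBall 0 ε)
    (hρc : HasCompactSupport (ρ : ℝ → ℂ)) {R : ℝ}
    (hR : fourierSpectrum f ⊆ Metric.closedBall 0 R) :
    Function.support (𝓕 (fun x => f x * 𝓕 (ρ : ℝ → ℂ) x)) ⊆ Metric.closedBall 0 (R + ε) := by
  intro ξ hξ
  by_contra hξ'
  refine hξ (fourier_mul_fourier_bump_eq_zero hf hC ρ hρ hρc ?_)
  refine Set.disjoint_left.2 fun y hy hy' => hξ' ?_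
  have hyR := hR hy'
  rw [Metric.mem_closedBall, dist_zero_right] at hyR ⊢
  rw [Metric.mem_closedBall, dist_eq_norm] at hy
  calc ‖ξ‖ = ‖y - (y - ξ)‖ := by rw [sub_sub_cancel]
    _ ≤ ‖y‖ + ‖y - ξ‖ := norm_sub_le _ _
    _ ≤ R + ε := add_le_add hyR hy

/-- `𝓕(f · 𝓕ρ)` has compact support when the spectrum of `f` is bounded. [folklore] -/
theorem hasCompactSupport_fourier_mul_fourier_bump (hf : Continuous f) (hC : ∀ x, ‖f x‖ ≤ C)
    (ρ : 𝓢(ℝ, ℂ)) {ε : ℝ} (hρ : tsupport (ρ : ℝ → ℂ) ⊆ Metric.closedBall 0 ε)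
    (hρc : HasCompactSupport (ρ : ℝ → ℂ)) {R : ℝ}
    (hR : fourierSpectrum f ⊆ Metric.closedBall 0 R) :
    HasCompactSupport (𝓕 (fun x => f x * 𝓕 (ρ : ℝ → ℂ) x)) :=
  HasCompactSupport.of_support_subset_isCompact (isCompact_closedBall 0 (R + ε))
    (support_fourier_mul_fourier_bump_subset hf hC ρ hρ hρc hR)

/-- `𝓕(f · 𝓕ρ)` is integrable when the spectrum of `f` is bounded. [folklore] -/
theorem integrable_fourier_mul_fourier_bump (hf : Continuous f) (hC : ∀ x, ‖f x‖ ≤ C)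
    (ρ : 𝓢(ℝ, ℂ)) {ε : ℝ} (hρ : tsupport (ρ : ℝ → ℂ) ⊆ Metric.closedBall 0 ε)
    (hρc : HasCompactSupport (ρ : ℝ → ℂ)) {R : ℝ}
    (hR : fourierSpectrum f ⊆ Metric.closedBall 0 R) :
    Integrable (𝓕 (fun x => f x * 𝓕 (ρ : ℝ → ℂ) x)) :=
  (continuous_fourier_mul_fourier_bump hf hC ρ).integrable_of_hasCompactSupport
    (hasCompactSupport_fourier_mul_fourier_bump hf hC ρ hρ hρc hR)

/-- **Fourier inversion for the regularised function**: `𝓕⁻𝓕(f · 𝓕ρ) = f · 𝓕ρ`.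
[folklore] -/
theorem fourierInv_fourier_mul_fourier_bump (hf : Continuous f) (hC : ∀ x, ‖f x‖ ≤ C)
    (ρ : 𝓢(ℝ, ℂ)) {ε : ℝ} (hρ : tsupport (ρ : ℝ → ℂ) ⊆ Metric.closedBall 0 ε)
    (hρc : HasCompactSupport (ρ : ℝ → ℂ)) {R : ℝ}
    (hR : fourierSpectrum f ⊆ Metric.closedBall 0 R) :
    𝓕⁻ (𝓕 (fun x => f x * 𝓕 (ρ : ℝ → ℂ) x)) = fun x => f x * 𝓕 (ρ : ℝ → ℂ) x :=
  (continuous_mul_fourier_bump hf ρ).fourierInv_fourier_eq (integrable_mul_fourier_bump hf hC ρ)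
    (integrable_fourier_mul_fourier_bump hf hC ρ hρ hρc hR)

/-- **`⟨(f𝓕ρ)^, φ⟩ = ∫ 𝓕(f𝓕ρ) φ`**: on the regularised function the distributional pairing is
integration against the (continuous, compactly supported) function `𝓕(f · 𝓕ρ)`. [folklore] -/
theorem integral_mul_fourier_bump_mul_fourier (hf : Continuous f) (hC : ∀ x, ‖f x‖ ≤ C)
    (ρ φ : 𝓢(ℝ, ℂ)) :
    ∫ x, (f x * 𝓕 (ρ : ℝ → ℂ) x) * 𝓕 (φ : ℝ → ℂ) x =
      ∫ ξ, 𝓕 (fun x => f x * 𝓕 (ρ : ℝ → ℂ) x) ξ * φ ξ :=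
  (integral_fourier_mul_eq_flip (integrable_mul_fourier_bump hf hC ρ)
    (φ.integrable (μ := volume))).symm

/-- **`(fψ · gψ)^ = (fψ)^ ⋆ (gψ)^`** for the regularised functions (`ψ = 𝓕ρ`): the convolution
theorem on the Fourier side, as functions. [cite: HormanderALPDO1, Thm. 7.1.15] -/
theorem fourier_mul_bump_mul_eq_convolution (hf : Continuous f) (hC : ∀ x, ‖f x‖ ≤ C)
    (hg : Continuous g) (hC' : ∀ x, ‖g x‖ ≤ C') (ρ : 𝓢(ℝ, ℂ)) {ε : ℝ}
    (hρ : tsupport (ρ : ℝ → ℂ) ⊆ Metric.closedBall 0 ε) (hρc : HasCompactSupport (ρ : ℝ → ℂ))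
    {R : ℝ} (hR : fourierSpectrum f ⊆ Metric.closedBall 0 R) :
    𝓕 (fun x => (f x * 𝓕 (ρ : ℝ → ℂ) x) * (g x * 𝓕 (ρ : ℝ → ℂ) x)) =
      𝓕 (fun x => f x * 𝓕 (ρ : ℝ → ℂ) x) ⋆[ContinuousLinearMap.mul ℂ ℂ]
        𝓕 (fun x => g x * 𝓕 (ρ : ℝ → ℂ) x) := by
  have h := fourier_fourierInv_mul_eq_convolution
    (integrable_fourier_mul_fourier_bump hf hC ρ hρ hρc hR) (integrable_mul_fourier_bump hg hC' ρ)
  rw [fourierInv_fourier_mul_fourier_bump hf hC ρ hρ hρc hR] at h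
  exact h

/-- **Weak convergence of the regularisations**: if `|ψ_n| ≤ 1` and `ψ_n → 1` pointwise, then
`∫ h ψ_n 𝓕φ → ∫ h 𝓕φ` (dominated convergence). [folklore] -/
theorem tendsto_integral_mul_mul_fourier {h : ℝ → ℂ} {C : ℝ} (hh : Continuous h)
    (hC : ∀ x, ‖h x‖ ≤ C) (ψ : ℕ → ℝ → ℂ) (hψc : ∀ n, Continuous (ψ n))
    (hψ1 : ∀ n x, ‖ψ n x‖ ≤ 1) (hψt : ∀ x, Tendsto (fun n => ψ n x) atTop (𝓝 1))
    (φ : 𝓢(ℝ, ℂ)) :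
    Tendsto (fun n => ∫ x, (h x * ψ n x) * 𝓕 (φ : ℝ → ℂ) x) atTop
      (𝓝 (∫ x, h x * 𝓕 (φ : ℝ → ℂ) x)) := by
  have hC0 : 0 ≤ C := (norm_nonneg _).trans (hC 0)
  refine tendsto_integral_of_dominated_convergence (fun x => C * ‖𝓕 (φ : ℝ → ℂ) x‖) ?_ ?_ ?_ ?_
  · exact fun n => ((hh.mul (hψc n)).mul (𝓕 φ).continuous).aestronglyMeasurable
  · exact (𝓕 φ).integrable.norm.const_mul C
  · intro n
    refine ae_of_all _ fun x => ?_
    rw [norm_mul, norm_mul]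
    calc ‖h x‖ * ‖ψ n x‖ * ‖𝓕 (φ : ℝ → ℂ) x‖ ≤ C * 1 * ‖𝓕 (φ : ℝ → ℂ) x‖ := by
          gcongr
          · exact hC x
          · exact hψ1 n x
      _ = C * ‖𝓕 (φ : ℝ → ℂ) x‖ := by rw [mul_one]
  · refine ae_of_all _ fun x => ?_
    have : Tendsto (fun n => h x * ψ n x * 𝓕 (φ : ℝ → ℂ) x) atTop
        (𝓝 (h x * 1 * 𝓕 (φ : ℝ → ℂ) x)) :=
      (tendsto_const_nhds.mul (hψt x)).mul tendsto_const_nhds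
    simpa using this

end Regularised

/-! ### Reflection `x ↦ -x` (reduces the `inf` statement to the `sup` statement) -/

/-- Support of a reflected function. [folklore] -/
theorem tsupport_comp_neg (φ : ℝ → ℂ) : tsupport (fun x => φ (-x)) = -tsupport φ := by
  have h : (fun x => φ (-x)) = φ ∘ (Homeomorph.neg ℝ) := rfl
  rw [h, tsupport, Function.support_comp_eq_preimage, ← Homeomorph.preimage_closure]
  rfl

/-- `∫ f(-x) 𝓕φ(x) dx = ∫ f(x) 𝓕(φ(-·))(x) dx`. [folklore] -/
theorem integral_comp_neg_mul_fourier (f : ℝ → ℂ) (φ : 𝓢(ℝ, ℂ)) :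
    ∫ x, f (-x) * 𝓕 (φ : ℝ → ℂ) x =
      ∫ x, f x * 𝓕 ((SchwartzMap.compCLMOfContinuousLinearEquiv ℂ
        (ContinuousLinearEquiv.neg ℝ) φ : 𝓢(ℝ, ℂ)) : ℝ → ℂ) x := by
  have hcoe : ((SchwartzMap.compCLMOfContinuousLinearEquiv ℂ (ContinuousLinearEquiv.neg ℝ) φ :
      𝓢(ℝ, ℂ)) : ℝ → ℂ) = fun x => φ (-x) := by
    funext x
    simp
  rw [hcoe, ← fourierInv_eq_fourier_comp_neg]
  simp_rw [fourierInv_eq_fourier_neg]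
  have h := integral_neg_eq_self (fun x => f x * 𝓕 (φ : ℝ → ℂ) (-x)) volume
  simp only [neg_neg] at h
  exact h

/-- **The spectrum of `f(-·)` is `-`(the spectrum of `f`)** (pointwise form). [folklore] -/
theorem mem_fourierSpectrum_comp_neg (f : ℝ → ℂ) (ξ : ℝ) :
    ξ ∈ fourierSpectrum (fun x => f (-x)) ↔ -ξ ∈ fourierSpectrum f := by
  set R : 𝓢(ℝ, ℂ) → 𝓢(ℝ, ℂ) := fun φ =>
    SchwartzMap.compCLMOfContinuousLinearEquiv ℂ (ContinuousLinearEquiv.neg ℝ) φ with hR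
  have hRcoe : ∀ φ : 𝓢(ℝ, ℂ), ((R φ : 𝓢(ℝ, ℂ)) : ℝ → ℂ) = fun x => φ (-x) := fun φ => by
    funext x
    simp [hR]
  have hRR : ∀ φ : 𝓢(ℝ, ℂ), R (R φ) = φ := fun φ => by
    ext x
    simp [hR]
  have hts : ∀ φ : 𝓢(ℝ, ℂ), tsupport ((R φ : 𝓢(ℝ, ℂ)) : ℝ → ℂ) = -tsupport (φ : ℝ → ℂ) :=
    fun φ => by rw [hRcoe, tsupport_comp_neg]
  have hnhds : ∀ (η : ℝ) (U : Set ℝ), U ∈ 𝓝 (-η) → -U ∈ 𝓝 η := fun η U hU =>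
    continuous_neg.continuousAt.preimage_mem_nhds hU
  simp only [mem_fourierSpectrum_iff]
  constructor
  · intro h U hU
    obtain ⟨φ, hφU, hne⟩ := h (-U) (hnhds ξ U hU)
    refine ⟨R φ, ?_, ?_⟩
    · rw [hts]
      intro x hx
      have := hφU (Set.mem_neg.1 hx)
      simpa using this
    · rwa [integral_comp_neg_mul_fourier] at hne
  · intro h U hU
    have hU' : -U ∈ 𝓝 (-ξ) := hnhds (-ξ) U (by simpa using hU)
    obtain ⟨φ, hφU, hne⟩ := h (-U) hU'
    refine ⟨R φ, ?_, ?_⟩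
    · rw [hts]
      intro x hx
      have := hφU (Set.mem_neg.1 hx)
      simpa using this
    · rw [integral_comp_neg_mul_fourier]
      change ∫ x, f x * 𝓕 ((R (R φ) : 𝓢(ℝ, ℂ)) : ℝ → ℂ) x ≠ 0
      rwa [hRR]

/-- **The spectrum of `f(-·)` is `-`(the spectrum of `f`)**. [folklore] -/
theorem fourierSpectrum_comp_neg (f : ℝ → ℂ) :
    fourierSpectrum (fun x => f (-x)) = -fourierSpectrum f := by
  ext ξ
  rw [mem_fourierSpectrum_comp_neg, Set.mem_neg]

/-! ### The spectrum of a non-zero bounded function is non-empty -/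

section Spectrum

variable {f g : ℝ → ℂ} {C C' : ℝ}

/-- The inverse Fourier transform of the zero function vanishes. [folklore] -/
theorem fourierInv_zero_fun (x : ℝ) : 𝓕⁻ (0 : ℝ → ℂ) x = 0 := by
  simp [Real.fourierInv_eq]

/-- **A non-zero bounded continuous function has non-empty spectrum** (`supp f̂ = ∅` forces
`f̂ = 0`, i.e. `f = 0`, Fourier inversion in `𝒮'`; here through the regularisations
`f · 𝓕ρ_n → f`, whose Fourier transforms vanish identically). [cite: HormanderALPDO1, Thm. 7.1.10] -/
theorem fourierSpectrum_nonempty (hf : Continuous f) (hC : ∀ x, ‖f x‖ ≤ C) (hf0 : f ≠ 0) :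
    (fourierSpectrum f).Nonempty := by
  by_contra hempty
  rw [Set.not_nonempty_iff_eq_empty] at hempty
  apply hf0
  have hex : ∀ n : ℕ, ∃ ρ : 𝓢(ℝ, ℂ), tsupport (ρ : ℝ → ℂ) ⊆ Metric.closedBall 0 (((n : ℝ) + 1)⁻¹) ∧
      HasCompactSupport (ρ : ℝ → ℂ) ∧ (∫ x, ρ x = 1) ∧ (∫ x, ‖ρ x‖ = 1) := fun n =>
    exists_normed_bump (by positivity)
  choose ρ hρs hρc hρ1 hρ1' using hex
  have hR : fourierSpectrum f ⊆ Metric.closedBall 0 0 := by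
    rw [hempty]
    exact Set.empty_subset _
  have hzero : ∀ n x, f x * 𝓕 (ρ n : ℝ → ℂ) x = 0 := by
    intro n x
    have hF0 : 𝓕 (fun x => f x * 𝓕 (ρ n : ℝ → ℂ) x) = 0 := by
      funext ξ
      refine fourier_mul_fourier_bump_eq_zero hf hC (ρ n) (hρs n) (hρc n) ?_
      rw [hempty]
      exact Set.disjoint_empty _
    have hinv := fourierInv_fourier_mul_fourier_bump hf hC (ρ n) (hρs n) (hρc n) hR
    rw [hF0] at hinv
    have hx := congrFun hinv x
    rw [fourierInv_zero_fun] at hx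
    exact hx.symm
  funext x
  have ht : Tendsto (fun n => f x * 𝓕 (ρ n : ℝ → ℂ) x) atTop (𝓝 (f x * 1)) :=
    tendsto_const_nhds.mul (tendsto_fourier_bump ρ hρs hρ1 hρ1' x)
  rw [mul_one] at ht
  have h0 : Tendsto (fun _ : ℕ => (0 : ℂ)) atTop (𝓝 (f x)) :=
    ht.congr fun n => hzero n x
  exact (tendsto_nhds_unique h0 tendsto_const_nhds)

/-- The supremum of a non-empty bounded spectrum belongs to it (the spectrum is closed).
[folklore] -/
theorem sSup_mem_fourierSpectrum (hne : (fourierSpectrum f).Nonempty)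
    (hb : Bornology.IsBounded (fourierSpectrum f)) :
    sSup (fourierSpectrum f) ∈ fourierSpectrum f :=
  (isClosed_fourierSpectrum f).csSup_mem hne hb.bddAbove

/-! ### The easy inclusion: `spec (fg) ⊆ (-∞, sup spec f + sup spec g]` -/

/-- `𝓕(f · 𝓕ρ)` vanishes above `sup spec f + ε`. [folklore] -/
theorem fourier_mul_fourier_bump_eq_zero_of_lt (hf : Continuous f) (hC : ∀ x, ‖f x‖ ≤ C)
    (ρ : 𝓢(ℝ, ℂ)) {ε : ℝ} (hρ : tsupport (ρ : ℝ → ℂ) ⊆ Metric.closedBall 0 ε)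
    (hρc : HasCompactSupport (ρ : ℝ → ℂ)) (hb : Bornology.IsBounded (fourierSpectrum f))
    {ξ : ℝ} (hξ : sSup (fourierSpectrum f) + ε < ξ) :
    𝓕 (fun x => f x * 𝓕 (ρ : ℝ → ℂ) x) ξ = 0 := by
  refine fourier_mul_fourier_bump_eq_zero hf hC ρ hρ hρc (Set.disjoint_left.2 fun y hy hy' => ?_)
  rw [Metric.mem_closedBall, Real.dist_eq] at hy
  have h1 : y ≤ sSup (fourierSpectrum f) := le_csSup hb.bddAbove hy'
  have h2 : ξ - ε ≤ y := by
    have := (abs_le.1 hy).1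
    linarith
  linarith

/-- A convolution of functions vanishing above `a` and above `b` vanishes above `a + b`.
[folklore] -/
theorem convolution_apply_eq_zero_of_lt {F G : ℝ → ℂ} {a b ξ : ℝ} (hF : ∀ x, a < x → F x = 0)
    (hG : ∀ x, b < x → G x = 0) (hξ : a + b < ξ) :
    (F ⋆[ContinuousLinearMap.mul ℂ ℂ] G) ξ = 0 := by
  by_contra h
  obtain ⟨x, hx, y, hy, hxy⟩ := support_convolution_subset _ (Function.mem_support.2 h)
  have hxa : x ≤ a := le_of_not_gt fun h' => hx (hF x h')
  have hyb : y ≤ b := le_of_not_gt fun h' => hy (hG y h')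
  have : ξ = x + y := hxy.symm
  linarith

/-- The convolution as printed in `Titchmarsh1926_convolution_support` is Mathlib's
`⋆[mul ℂ ℂ]`. [folklore] -/
theorem convolution_mul_eq (F G : ℝ → ℂ) :
    (F ⋆[ContinuousLinearMap.mul ℂ ℂ] G) = fun x => ∫ t, F t * G (x - t) := by
  funext x
  simp only [convolution_def, ContinuousLinearMap.mul_apply']

/-- **`(fg)^` vanishes on `(sup spec f + sup spec g, ∞)`**: for every Schwartz `φ` with compact
support in that half-line, `∫ f g · 𝓕φ = 0` (the inclusion
`supp (f̂ ∗ ĝ) ⊆ supp f̂ + supp ĝ`, through the regularisations).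
[cite: HormanderALPDO1, Thm. 4.3.3 (easy half, (4.2.3))] -/
theorem integral_mul_mul_fourier_eq_zero_of_subset_Ioi (hf : Continuous f) (hC : ∀ x, ‖f x‖ ≤ C)
    (hg : Continuous g) (hC' : ∀ x, ‖g x‖ ≤ C') (hbf : Bornology.IsBounded (fourierSpectrum f))
    (hbg : Bornology.IsBounded (fourierSpectrum g)) (φ : 𝓢(ℝ, ℂ))
    (hφc : HasCompactSupport (φ : ℝ → ℂ))
    (hφ : tsupport (φ : ℝ → ℂ) ⊆ Set.Ioi (sSup (fourierSpectrum f) + sSup (fourierSpectrum g))) :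
    ∫ x, (f x * g x) * 𝓕 (φ : ℝ → ℂ) x = 0 := by
  set c := sSup (fourierSpectrum f) + sSup (fourierSpectrum g) with hc
  -- the support of `φ` keeps a positive distance from `c`
  by_cases hφ0 : tsupport (φ : ℝ → ℂ) = ∅
  · have : (φ : ℝ → ℂ) = 0 := by
      funext x
      exact image_eq_zero_of_notMem_tsupport (by rw [hφ0]; exact Set.notMem_empty x)
    have h0 : 𝓕 (0 : ℝ → ℂ) = 0 := by
      funext x
      simp [Real.fourier_real_eq]
    simp [this, h0]
  obtain ⟨m, hm, hmin⟩ := hφc.isCompact.exists_isMinOn (Set.nonempty_iff_ne_empty.2 hφ0)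
    continuous_id.continuousOn
  have hmc : c < m := hφ hm
  -- bumps and their self-convolutions
  have hex : ∀ n : ℕ, ∃ ρ : 𝓢(ℝ, ℂ), tsupport (ρ : ℝ → ℂ) ⊆ Metric.closedBall 0 (((n : ℝ) + 1)⁻¹) ∧
      HasCompactSupport (ρ : ℝ → ℂ) ∧ (∫ x, ρ x = 1) ∧ (∫ x, ‖ρ x‖ = 1) := fun n =>
    exists_normed_bump (by positivity)
  choose ρ hρs hρc hρ1 hρ1' using hex
  have hCC : ∀ x, ‖f x * g x‖ ≤ C * C' := fun x => by
    rw [norm_mul]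
    exact mul_le_mul (hC x) (hC' x) (norm_nonneg _) ((norm_nonneg _).trans (hC 0))
  -- the limit
  have hlim : Tendsto (fun n => ∫ x, ((f x * g x) * (𝓕 (ρ n : ℝ → ℂ) x * 𝓕 (ρ n : ℝ → ℂ) x)) *
      𝓕 (φ : ℝ → ℂ) x) atTop (𝓝 (∫ x, (f x * g x) * 𝓕 (φ : ℝ → ℂ) x)) := by
    refine tendsto_integral_mul_mul_fourier (hf.mul hg) hCC
      (fun n x => 𝓕 (ρ n : ℝ → ℂ) x * 𝓕 (ρ n : ℝ → ℂ) x)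
      (fun n => (𝓕 (ρ n)).continuous.mul (𝓕 (ρ n)).continuous) (fun n x => ?_) (fun x => ?_) φ
    · rw [norm_mul]
      have h1 := norm_fourier_le_one_of_integral_norm (ρ n) (hρ1' n) x
      exact mul_le_one₀ h1 (norm_nonneg _) h1
    · simpa using (tendsto_fourier_bump ρ hρs hρ1 hρ1' x).mul (tendsto_fourier_bump ρ hρs hρ1 hρ1' x)
  -- the terms vanish eventually
  have hev : ∀ᶠ n : ℕ in atTop, ∫ x, ((f x * g x) * (𝓕 (ρ n : ℝ → ℂ) x * 𝓕 (ρ n : ℝ → ℂ) x)) *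
      𝓕 (φ : ℝ → ℂ) x = 0 := by
    have hε : Tendsto (fun n : ℕ => ((n : ℝ) + 1)⁻¹) atTop (𝓝 0) := by
      simpa only [one_div] using tendsto_one_div_add_atTop_nhds_zero_nat (𝕜 := ℝ)
    have hev' : ∀ᶠ n : ℕ in atTop, ((n : ℝ) + 1)⁻¹ < (m - c) / 2 :=
      hε (Iio_mem_nhds (by linarith))
    filter_upwards [hev'] with n hn
    obtain ⟨R, hR⟩ := (Metric.isBounded_iff_subset_closedBall 0).1 hbf
    -- rewrite the integrand as `(f𝓕ρ)(g𝓕ρ) · 𝓕φ` and use the multiplication formula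
    have hfg : ∀ x, (f x * g x) * (𝓕 (ρ n : ℝ → ℂ) x * 𝓕 (ρ n : ℝ → ℂ) x) =
        (f x * 𝓕 (ρ n : ℝ → ℂ) x * g x) * 𝓕 (ρ n : ℝ → ℂ) x := fun x => by ring
    simp_rw [hfg]
    have hbd : ∀ x, ‖f x * 𝓕 (ρ n : ℝ → ℂ) x * g x‖ ≤ C * 1 * C' := fun x => by
      rw [norm_mul, norm_mul]
      refine mul_le_mul (mul_le_mul (hC x) (norm_fourier_le_one_of_integral_norm _ (hρ1' n) x)
        (norm_nonneg _) ((norm_nonneg _).trans (hC 0))) (hC' x) (norm_nonneg _) ?_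
      exact mul_nonneg ((norm_nonneg _).trans (hC 0)) zero_le_one
    have hcont : Continuous fun x => f x * 𝓕 (ρ n : ℝ → ℂ) x * g x :=
      (hf.mul (𝓕 (ρ n)).continuous).mul hg
    have h2 := integral_mul_fourier_bump_mul_fourier hcont hbd (ρ n) φ
    beta_reduce at h2
    rw [h2]
    have hprod : (fun x => f x * 𝓕 (ρ n : ℝ → ℂ) x * g x * 𝓕 (ρ n : ℝ → ℂ) x) =
        fun x => (f x * 𝓕 (ρ n : ℝ → ℂ) x) * (g x * 𝓕 (ρ n : ℝ → ℂ) x) := by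
      funext x; ring
    rw [hprod, fourier_mul_bump_mul_eq_convolution hf hC hg hC' (ρ n) (hρs n) (hρc n) hR]
    refine integral_eq_zero_of_ae (ae_of_all _ fun ξ => ?_)
    change (𝓕 (fun x => f x * 𝓕 (ρ n : ℝ → ℂ) x) ⋆[ContinuousLinearMap.mul ℂ ℂ]
      𝓕 (fun x => g x * 𝓕 (ρ n : ℝ → ℂ) x)) ξ * φ ξ = 0
    by_cases hξ : ξ ∈ tsupport (φ : ℝ → ℂ)
    · have hmξ : m ≤ ξ := hmin hξ
      rw [convolution_apply_eq_zero_of_lt (F := 𝓕 (fun x => f x * 𝓕 (ρ n : ℝ → ℂ) x))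
        (G := 𝓕 (fun x => g x * 𝓕 (ρ n : ℝ → ℂ) x))
        (fun x hx => fourier_mul_fourier_bump_eq_zero_of_lt hf hC (ρ n) (hρs n) (hρc n) hbf hx)
        (fun x hx => fourier_mul_fourier_bump_eq_zero_of_lt hg hC' (ρ n) (hρs n) (hρc n) hbg hx)
        (by linarith), zero_mul]
    · rw [image_eq_zero_of_notMem_tsupport hξ, mul_zero]
  exact tendsto_nhds_unique (tendsto_const_nhds.congr' (hev.mono fun n hn => hn.symm)) hlim ▸ rfl

/-! ### The lower bound: `sup spec f + sup spec g ∈ spec (fg)` (Titchmarsh's theorem) -/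

/-- **`sup spec f + sup spec g` lies in the spectrum of `fg`** — the theorem of supports on the
Fourier side, obtained from Titchmarsh's convolution theorem for functions
(`Titchmarsh1926_convolution_support`) applied to the continuous compactly supported functions
`𝓕(f · 𝓕ρ_n)`, `𝓕(g · 𝓕ρ_n)` and a weak limit. [cite: HormanderALPDO1, Thm. 4.3.3]
[cite: Titchmarsh1926, Thm. VII] -/
theorem sSup_add_sSup_mem_fourierSpectrum_mul (hT : Titchmarsh1926_convolution_support)
    (hf : Continuous f) (hC : ∀ x, ‖f x‖ ≤ C) (hg : Continuous g) (hC' : ∀ x, ‖g x‖ ≤ C')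
    (hf0 : f ≠ 0) (hg0 : g ≠ 0) (hbf : Bornology.IsBounded (fourierSpectrum f))
    (hbg : Bornology.IsBounded (fourierSpectrum g)) :
    sSup (fourierSpectrum f) + sSup (fourierSpectrum g) ∈ fourierSpectrum (f * g) := by
  set bf := sSup (fourierSpectrum f) with hbf_def
  set bg := sSup (fourierSpectrum g) with hbg_def
  by_contra hcon
  -- `(fg)^` vanishes on a neighbourhood `(c - 4δ, c + 4δ)` of `c = bf + bg`
  have hcon' := hcon
  simp only [mem_fourierSpectrum_iff, not_forall, not_exists, not_and, not_not] at hcon'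
  obtain ⟨U, hU, hUΛ⟩ := hcon'
  obtain ⟨r, hr, hrU⟩ := Metric.mem_nhds_iff.1 hU
  set δ := r / 4 with hδ
  have hδ0 : 0 < δ := by positivity
  have hIoo : Set.Ioo (bf + bg - 4 * δ) (bf + bg + 4 * δ) ⊆ U := by
    rw [Real.ball_eq_Ioo] at hrU
    have h4 : 4 * δ = r := by rw [hδ]; ring
    rw [h4]
    exact hrU
  -- bounds for `fg`
  have hCC : ∀ x, ‖(f * g) x‖ ≤ C * C' := fun x => by
    rw [Pi.mul_apply, norm_mul]
    exact mul_le_mul (hC x) (hC' x) (norm_nonneg _) ((norm_nonneg _).trans (hC 0))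
  have hfgc : Continuous (f * g) := hf.mul hg
  -- `(fg)^` vanishes on `(c - 4δ, ∞)` against compactly supported test functions (gluing)
  have hvan : ∀ θ : 𝓢(ℝ, ℂ), HasCompactSupport (θ : ℝ → ℂ) →
      tsupport (θ : ℝ → ℂ) ⊆ Set.Ioi (bf + bg - 4 * δ) →
        ∫ x, (f * g) x * 𝓕 (θ : ℝ → ℂ) x = 0 := by
    intro θ hθc hθs
    let Λ : 𝓢(ℝ, ℂ) →ₗ[ℂ] ℂ :=
      { toFun := fun θ => ∫ x, (f * g) x * 𝓕 (θ : ℝ → ℂ) x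
        map_add' := fun θ₁ θ₂ => integral_mul_fourier_add hfgc.aestronglyMeasurable hCC θ₁ θ₂
        map_smul' := fun a θ => integral_mul_fourier_smul (f * g) a θ }
    change Λ θ = 0
    refine linearMap_apply_eq_zero_of_locally_zero Λ θ hθc fun x hx => ?_
    have hx' : bf + bg - 4 * δ < x := hθs hx
    by_cases hxc : x < bf + bg + 4 * δ
    · exact ⟨Set.Ioo (bf + bg - 4 * δ) (bf + bg + 4 * δ), Ioo_mem_nhds hx' hxc,
        fun θ' _ hθ' => hUΛ θ' (hθ'.trans hIoo)⟩
    · refine ⟨Set.Ioi (bf + bg), Ioi_mem_nhds (by linarith), fun θ' hθ'c hθ' => ?_⟩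
      have := integral_mul_mul_fourier_eq_zero_of_subset_Ioi hf hC hg hC' hbf hbg θ' hθ'c hθ'
      change ∫ x, (f * g) x * 𝓕 (θ' : ℝ → ℂ) x = 0
      simpa only [Pi.mul_apply] using this
  -- test functions detecting `bf ∈ spec f` and `bg ∈ spec g`
  have hbf_mem : bf ∈ fourierSpectrum f :=
    sSup_mem_fourierSpectrum (fourierSpectrum_nonempty hf hC hf0) hbf
  have hbg_mem : bg ∈ fourierSpectrum g :=
    sSup_mem_fourierSpectrum (fourierSpectrum_nonempty hg hC' hg0) hbg
  obtain ⟨φf, hφf_supp, hφf_ne⟩ := hbf_mem (Set.Ioo (bf - δ) (bf + 1))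
    (Ioo_mem_nhds (by linarith) (by linarith))
  obtain ⟨φg, hφg_supp, hφg_ne⟩ := hbg_mem (Set.Ioo (bg - δ) (bg + 1))
    (Ioo_mem_nhds (by linarith) (by linarith))
  -- bumps
  have hex : ∀ n : ℕ, ∃ ρ : 𝓢(ℝ, ℂ), tsupport (ρ : ℝ → ℂ) ⊆ Metric.closedBall 0 (((n : ℝ) + 1)⁻¹) ∧
      HasCompactSupport (ρ : ℝ → ℂ) ∧ (∫ x, ρ x = 1) ∧ (∫ x, ‖ρ x‖ = 1) := fun n =>
    exists_normed_bump (by positivity)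
  choose ρ hρs hρc hρ1 hρ1' using hex
  obtain ⟨Rf, hRf⟩ := (Metric.isBounded_iff_subset_closedBall 0).1 hbf
  obtain ⟨Rg, hRg⟩ := (Metric.isBounded_iff_subset_closedBall 0).1 hbg
  -- the pairings of the regularisations against `φf`, `φg` converge to non-zero limits
  have hlimf : Tendsto (fun n => ∫ x, (f x * 𝓕 (ρ n : ℝ → ℂ) x) * 𝓕 (φf : ℝ → ℂ) x) atTop
      (𝓝 (∫ x, f x * 𝓕 (φf : ℝ → ℂ) x)) :=
    tendsto_integral_mul_mul_fourier hf hC (fun n x => 𝓕 (ρ n : ℝ → ℂ) x)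
      (fun n => (𝓕 (ρ n)).continuous) (fun n x => norm_fourier_le_one_of_integral_norm _ (hρ1' n) x)
      (fun x => tendsto_fourier_bump ρ hρs hρ1 hρ1' x) φf
  have hlimg : Tendsto (fun n => ∫ x, (g x * 𝓕 (ρ n : ℝ → ℂ) x) * 𝓕 (φg : ℝ → ℂ) x) atTop
      (𝓝 (∫ x, g x * 𝓕 (φg : ℝ → ℂ) x)) :=
    tendsto_integral_mul_mul_fourier hg hC' (fun n x => 𝓕 (ρ n : ℝ → ℂ) x)
      (fun n => (𝓕 (ρ n)).continuous) (fun n x => norm_fourier_le_one_of_integral_norm _ (hρ1' n) x)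
      (fun x => tendsto_fourier_bump ρ hρs hρ1 hρ1' x) φg
  have hevf : ∀ᶠ n in atTop, ∫ x, (f x * 𝓕 (ρ n : ℝ → ℂ) x) * 𝓕 (φf : ℝ → ℂ) x ≠ 0 :=
    hlimf.eventually_ne hφf_ne
  have hevg : ∀ᶠ n in atTop, ∫ x, (g x * 𝓕 (ρ n : ℝ → ℂ) x) * 𝓕 (φg : ℝ → ℂ) x ≠ 0 :=
    hlimg.eventually_ne hφg_ne
  have hε : Tendsto (fun n : ℕ => ((n : ℝ) + 1)⁻¹) atTop (𝓝 0) := by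
    simpa only [one_div] using tendsto_one_div_add_atTop_nhds_zero_nat (𝕜 := ℝ)
  have hevε : ∀ᶠ n : ℕ in atTop, ((n : ℝ) + 1)⁻¹ < δ / 2 := hε (Iio_mem_nhds (by positivity))
  -- the key alternative, for `n` large: one of the two pairings vanishes
  have hkey : ∀ n : ℕ, ((n : ℝ) + 1)⁻¹ < δ / 2 →
      (∫ x, (f x * 𝓕 (ρ n : ℝ → ℂ) x) * 𝓕 (φf : ℝ → ℂ) x = 0) ∨
        (∫ x, (g x * 𝓕 (ρ n : ℝ → ℂ) x) * 𝓕 (φg : ℝ → ℂ) x = 0) := by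
    intro n hn
    set ε := ((n : ℝ) + 1)⁻¹ with hεdef
    set F : ℝ → ℂ := 𝓕 (fun x => f x * 𝓕 (ρ n : ℝ → ℂ) x) with hF
    set G : ℝ → ℂ := 𝓕 (fun x => g x * 𝓕 (ρ n : ℝ → ℂ) x) with hG
    have hFc : Continuous F := continuous_fourier_mul_fourier_bump hf hC (ρ n)
    have hGc : Continuous G := continuous_fourier_mul_fourier_bump hg hC' (ρ n)
    have hFcs : HasCompactSupport F :=
      hasCompactSupport_fourier_mul_fourier_bump hf hC (ρ n) (hρs n) (hρc n) hRf
    have hGcs : HasCompactSupport G :=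
      hasCompactSupport_fourier_mul_fourier_bump hg hC' (ρ n) (hρs n) (hρc n) hRg
    have hAf : ∫ x, (f x * 𝓕 (ρ n : ℝ → ℂ) x) * 𝓕 (φf : ℝ → ℂ) x = ∫ ξ, F ξ * φf ξ :=
      integral_mul_fourier_bump_mul_fourier hf hC (ρ n) φf
    have hAg : ∫ x, (g x * 𝓕 (ρ n : ℝ → ℂ) x) * 𝓕 (φg : ℝ → ℂ) x = ∫ ξ, G ξ * φg ξ :=
      integral_mul_fourier_bump_mul_fourier hg hC' (ρ n) φg
    -- `F ⋆ G = 𝓕((fg) · 𝓕σ)` with `σ = ρ_n ⋆ ρ_n`, hence vanishes above `c - 4δ + 2ε`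
    obtain ⟨σ, hσF, hσs, hσc⟩ := exists_self_convolution (ρ n) (hρs n)
    have hH : 𝓕 (fun x => (f * g) x * 𝓕 (σ : ℝ → ℂ) x) = F ⋆[ContinuousLinearMap.mul ℂ ℂ] G := by
      have h1 := fourier_mul_bump_mul_eq_convolution hf hC hg hC' (ρ n) (hρs n) (hρc n) hRf
      have h2 : (fun x => (f * g) x * 𝓕 (σ : ℝ → ℂ) x) =
          fun x => (f x * 𝓕 (ρ n : ℝ → ℂ) x) * (g x * 𝓕 (ρ n : ℝ → ℂ) x) := by
        funext x
        rw [Pi.mul_apply, hσF]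
        ring
      rw [h2, h1]
    have hHzero : ∀ ξ, bf + bg - 4 * δ + 2 * ε < ξ →
        (F ⋆[ContinuousLinearMap.mul ℂ ℂ] G) ξ = 0 := by
      intro ξ hξ
      rw [← hH, fourier_mul_fourier_apply]
      refine hvan _ (hasCompactSupport_compSubConst σ ξ hσc) ?_
      refine (tsupport_compSubConst_subset σ ξ hσs).trans fun y hy => ?_
      rw [Metric.mem_closedBall, Real.dist_eq] at hy
      change bf + bg - 4 * δ < y
      have := (abs_le.1 hy).1
      linarith
    -- the degenerate cases
    by_cases hF0 : F = 0
    · left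
      rw [hAf, hF0]
      simp
    by_cases hG0 : G = 0
    · right
      rw [hAg, hG0]
      simp
    -- Titchmarsh's theorem for the functions `F`, `G`
    obtain ⟨hinf, hsup⟩ := hT F G hFc hGc hFcs hGcs hF0 hG0
    rw [← convolution_mul_eq] at hinf hsup
    have hFbdd : Bornology.IsBounded (Function.support F) :=
      hFcs.isCompact.isBounded.subset (subset_tsupport _)
    have hGbdd : Bornology.IsBounded (Function.support G) :=
      hGcs.isCompact.isBounded.subset (subset_tsupport _)
    have hFne : (Function.support F).Nonempty := Function.support_nonempty_iff.2 hF0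
    have hGne : (Function.support G).Nonempty := Function.support_nonempty_iff.2 hG0
    -- `sup supp F + sup supp G ≤ c - 4δ + 2ε`
    have hsum : sSup (Function.support F) + sSup (Function.support G) ≤ bf + bg - 4 * δ + 2 * ε := by
      by_cases hHne : (Function.support (F ⋆[ContinuousLinearMap.mul ℂ ℂ] G)).Nonempty
      · rw [← hsup]
        exact csSup_le hHne fun ξ hξ => le_of_not_gt fun hlt => hξ (hHzero ξ hlt)
      · -- empty support of the convolution is incompatible with the theorem of supports
        exfalso
        rw [Set.not_nonempty_iff_eq_empty] at hHne
        rw [hHne, Real.sSup_empty] at hsup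
        rw [hHne, Real.sInf_empty] at hinf
        have h1 : sInf (Function.support F) ≤ sSup (Function.support F) :=
          csInf_le_csSup hFne hFbdd.bddBelow hFbdd.bddAbove
        have h2 : sInf (Function.support G) ≤ sSup (Function.support G) :=
          csInf_le_csSup hGne hGbdd.bddBelow hGbdd.bddAbove
        have h3 : sInf (Function.support F) = sSup (Function.support F) := by linarith
        obtain ⟨x₀, hx₀⟩ := hFne
        obtain ⟨η, hη, hball⟩ := Metric.isOpen_iff.1 hFc.isOpen_support x₀ hx₀
        have hmem : x₀ + η / 2 ∈ Function.support F := hball (by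
          rw [Metric.mem_ball, Real.dist_eq, add_sub_cancel_left, abs_of_pos (half_pos hη)]
          linarith)
        have hle1 : x₀ + η / 2 ≤ sSup (Function.support F) := le_csSup hFbdd.bddAbove hmem
        have hge1 : sSup (Function.support F) ≤ x₀ := by
          rw [← h3]
          exact csInf_le hFbdd.bddBelow hx₀
        linarith
    -- so one of the supports ends before `bf - δ` (resp. `bg - δ`)
    have halt : sSup (Function.support F) < bf - δ ∨ sSup (Function.support G) < bg - δ := by
      by_contra h
      rw [not_or, not_lt, not_lt] at h
      linarith [h.1, h.2]
    rcases halt with hlt | hlt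
    · left
      rw [hAf]
      refine integral_eq_zero_of_ae (ae_of_all _ fun ξ => ?_)
      change F ξ * φf ξ = 0
      by_cases hξ : ξ ∈ tsupport (φf : ℝ → ℂ)
      · have hξ' : bf - δ < ξ := (hφf_supp hξ).1
        have hFξ : F ξ = 0 := by
          by_contra hne
          have := le_csSup hFbdd.bddAbove (Function.mem_support.2 hne)
          linarith
        rw [hFξ, zero_mul]
      · rw [image_eq_zero_of_notMem_tsupport hξ, mul_zero]
    · right
      rw [hAg]
      refine integral_eq_zero_of_ae (ae_of_all _ fun ξ => ?_)
      change G ξ * φg ξ = 0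
      by_cases hξ : ξ ∈ tsupport (φg : ℝ → ℂ)
      · have hξ' : bg - δ < ξ := (hφg_supp hξ).1
        have hGξ : G ξ = 0 := by
          by_contra hne
          have := le_csSup hGbdd.bddAbove (Function.mem_support.2 hne)
          linarith
        rw [hGξ, zero_mul]
      · rw [image_eq_zero_of_notMem_tsupport hξ, mul_zero]
  -- contradiction
  obtain ⟨n, ⟨hn1, hn2⟩, hn3⟩ := ((hevf.and hevg).and hevε).exists
  rcases hkey n hn3 with h | h
  · exact hn1 h
  · exact hn2 h

/-- **`sup spec (fg) = sup spec f + sup spec g`** (given the theorem of supports for functions).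
[cite: HormanderALPDO1, Thm. 4.3.3] -/
theorem sSup_fourierSpectrum_mul (hT : Titchmarsh1926_convolution_support)
    (hf : Continuous f) (hC : ∀ x, ‖f x‖ ≤ C) (hg : Continuous g) (hC' : ∀ x, ‖g x‖ ≤ C')
    (hf0 : f ≠ 0) (hg0 : g ≠ 0) (hbf : Bornology.IsBounded (fourierSpectrum f))
    (hbg : Bornology.IsBounded (fourierSpectrum g)) :
    sSup (fourierSpectrum (f * g)) = sSup (fourierSpectrum f) + sSup (fourierSpectrum g) := by
  refine IsGreatest.csSup_eq ⟨sSup_add_sSup_mem_fourierSpectrum_mul hT hf hC hg hC' hf0 hg0 hbf hbg,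
    fun ξ hξ => ?_⟩
  by_contra hlt
  rw [not_le] at hlt
  obtain ⟨φ, hφs, hφne⟩ := hξ (Set.Ioo (sSup (fourierSpectrum f) + sSup (fourierSpectrum g)) (ξ + 1))
    (Ioo_mem_nhds hlt (by linarith))
  refine hφne ?_
  have hφc : HasCompactSupport (φ : ℝ → ℂ) :=
    Metric.isCompact_of_isClosed_isBounded (isClosed_tsupport _) (Metric.isBounded_Ioo _ _ |>.subset hφs)
  have := integral_mul_mul_fourier_eq_zero_of_subset_Ioi hf hC hg hC' hbf hbg φ hφc
    (hφs.trans Set.Ioo_subset_Ioi_self)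
  simpa only [Pi.mul_apply] using this

end Spectrum

/-! ### The theorem -/

/-- **Exact spectral radii add under multiplication, given the theorem of supports for
functions**: `Titchmarsh1926_convolution_support → Titchmarsh_fourierSpectrum_mul`. The `inf`
statement follows from the `sup` statement by the reflection `x ↦ -x`.
[cite: HormanderALPDO1, Thm. 4.3.3 with Thm. 7.1.15] [cite: Titchmarsh1926, Thm. VII] -/
theorem Titchmarsh_fourierSpectrum_mul_of_convolution_support
    (hT : Titchmarsh1926_convolution_support) : Titchmarsh_fourierSpectrum_mul := by
  rintro f g hf hg ⟨C, hC⟩ ⟨C', hC'⟩ hf0 hg0 hbf hbg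
  refine ⟨sSup_fourierSpectrum_mul hT hf hC hg hC' hf0 hg0 hbf hbg, ?_⟩
  -- the `inf` statement, by reflection
  have hne : ∀ {h : ℝ → ℂ}, h ≠ 0 → (fun x => h (-x)) ≠ 0 := by
    intro h hh0 h0
    apply hh0
    funext x
    have := congrFun h0 (-x)
    simpa using this
  have hbd : ∀ {h : ℝ → ℂ}, Bornology.IsBounded (fourierSpectrum h) →
      Bornology.IsBounded (fourierSpectrum fun x => h (-x)) := by
    intro h hb
    rw [fourierSpectrum_comp_neg]
    obtain ⟨R, hR⟩ := (Metric.isBounded_iff_subset_closedBall 0).1 hb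
    refine (Metric.isBounded_iff_subset_closedBall 0).2 ⟨R, fun x hx => ?_⟩
    have := hR (Set.mem_neg.1 hx)
    simpa using this
  have key := sSup_fourierSpectrum_mul hT (f := fun x => f (-x)) (g := fun x => g (-x))
    (hf.comp continuous_neg) (fun x => hC (-x)) (hg.comp continuous_neg) (fun x => hC' (-x))
    (hne hf0) (hne hg0) (hbd hbf) (hbd hbg)
  have hprod : ((fun x => f (-x)) * fun x => g (-x)) = fun x => (f * g) (-x) := rfl
  rw [hprod, fourierSpectrum_comp_neg f, fourierSpectrum_comp_neg g,
    fourierSpectrum_comp_neg (f * g)] at key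
  rw [Real.sInf_def, Real.sInf_def, Real.sInf_def, key]
  ring

/-- **Exact spectral radii add under multiplication** (Titchmarsh–Lions theorem of supports on
the Fourier side; Hörmander Thm. 4.3.3 applied to `f̂, ĝ ∈ ℰ'(ℝ)` with Thm. 7.1.15): for
non-zero bounded continuous `f, g : ℝ → ℂ` with bounded spectra,
`sup spec (fg) = sup spec f + sup spec g` and `inf spec (fg) = inf spec f + inf spec g`.
DISCHARGES the named fact `Titchmarsh_fourierSpectrum_mul`.
[cite: HormanderALPDO1, Thm. 4.3.3 with Thm. 7.1.15] [cite: Titchmarsh1926, Thm. VII] -/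
theorem Titchmarsh_fourierSpectrum_mul_holds : Titchmarsh_fourierSpectrum_mul :=
  Titchmarsh_fourierSpectrum_mul_of_convolution_support Titchmarsh1926_convolution_support_holds

end Literature.Analysis.Fourier
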